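import Literature.InformationTheory.Entropy.KleinInequality
import Literature.InformationTheory.Entropy.ConditionalEntropyConcavity
import Literature.InformationTheory.Entropy.QuantumLeftoverHashingSmooth
import Literature.Probability.Entropy.PinskerInequality
import HarnessLib

/-!
# The quantum Pinsker inequality, joint convexity over finite families, and monotonicity of the
# relative entropy under mixed-unitary channels and pinchings (Watrous 2018, Corollary 5.33,
# Proposition 5.34, Theorem 5.38; Nielsen–Chuang Theorem 11.7 equality case)

Topic `InformationTheory/Entropy`, namespace `Literature.InformationTheory.Entropy`. Vocabulary: the tree's
`quantumRelEntropy` (`D`, cfc-log), `vonNeumannEntropy` (`H`), `IsDensity`, the trace norm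
`QuantumLeftoverHash.trNorm` (`‖S‖₁ = Σ|λ_i(S)|`, `QuantumLeftoverHashToolkit.lean`), and the classical
total variation distance `Literature.Probability.MarkovChains.tvDist`. Everything is PROVED; no
definition, no named fact.

* §1 **Joint convexity over finite positive definite families**: `D(Σₓρₓ ‖ Σₓσₓ) ≤ Σₓ D(ρₓ‖σₓ)`
  (`quantumRelEntropy_sum_le`) and the weighted form `D(Σ pₓρₓ ‖ Σ pₓσₓ) ≤ Σ pₓ D(ρₓ‖σₓ)`, `p ≥ 0`
  (`quantumRelEntropy_convexComb_le`) [cite: Watrous2018, Theorem 5.32 and Corollary 5.33] — deviating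
  from Watrous' route through Lieb's concavity theorem, these are obtained (as the tree's two-point
  `QuantumLattice.quantumRelEntropy_convex_combination_le`) from Lindblad's monotonicity under the partial
  trace (`re_trace_traceRight_mul_log_sub_log_le`, tree) applied to the block-diagonal pair
  `(⊕ₓρₓ, ⊕ₓσₓ)`. [cite: Lindblad1975, Lemma 2 p.149]
* §2 **Proposition 5.34** for positive definite inputs: `D(Φ(ρ)‖Φ(σ)) ≤ D(ρ‖σ)` for a mixed-unitary
  channel `Φ(X) = Σₐ p(a) UₐXUₐ⋆` (`quantumRelEntropy_mixedUnitary_le`: joint convexity + the unitary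
  invariance `quantumRelEntropy_unitary_conj` of `KleinInequality.lean`, exactly (5.173)).
  [cite: Watrous2018, Proposition 5.34]
* §3 **Pinching**: the complete dephasing is the uniform average of the `2^{|d|}` sign conjugations
  `diag(±1) X diag(±1)` (`sum_signDiag_conj_eq_diagonal`), hence `D(diag ρ ‖ diag σ) ≤ D(ρ‖σ)` for
  positive definite `ρ, σ` (`quantumRelEntropy_diagonal_diag_le`) — the measurement step (5.193).
  [cite: Watrous2018, Theorem 5.38 (proof, eq. (5.193)); §4.1.2 (completely dephasing channels are mixed-unitary)]
* §4 **Theorem 5.38 (quantum Pinsker)** `D(ρ‖σ) ≥ ½‖ρ − σ‖₁²` (natural logarithm): for positive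
  definite densities (`half_trNorm_sq_le_quantumRelEntropy_of_posDef`, proof as printed with the
  measurement taken in the eigenbasis of `ρ − σ`, where (5.191) `‖p − q‖₁ = ‖ρ − σ‖₁` is an identity,
  and the classical Pinsker inequality Theorem 5.15 = the tree's
  `Literature.Probability.Entropy.two_mul_tvDist_sq_le_kl`), then for every density `ρ` and positive
  definite density `σ` (`half_trNorm_sq_le_quantumRelEntropy`) by the approximation `ρ_ε = (1−ε)ρ + εσ`,
  `ε → 0⁺` (`D(ρ_ε‖σ) → D(ρ‖σ)` from the tree's `tendsto_cfc_of_density`, and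
  `‖ρ_ε − σ‖₁ ≥ (1−ε)‖ρ − σ‖₁` from `trNorm_smul_le`). [cite: Watrous2018, Theorem 5.38]
  Consequences: the EQUALITY CASE OF KLEIN'S INEQUALITY `D(ρ‖σ) ≤ 0 ⟹ ρ = σ`, `D(ρ‖σ) = 0 ⟺ ρ = σ`
  (`eq_of_quantumRelEntropy_le_zero`, `quantumRelEntropy_eq_zero_iff`) [cite: NielsenChuang2010, Theorem 11.7],
  and the uniqueness of the maximally mixed state as entropy maximiser, `H(ρ) = log d ⟹ ρ = 𝟙/d`
  (`eq_uniform_of_vonNeumannEntropy_eq_log_card`, via `quantumRelEntropy_uniform`)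
  [cite: NielsenChuang2010, Theorem 11.8 (2)]; `eq_zero_of_trNorm_eq_zero`.

With the tree's finite convention for `D` the hypothesis `σ ≻ 0` in §4 is genuinely needed (for
`im ρ ⊄ im σ` the source's `D(ρ‖σ)` is `+∞`). Not here: Proposition 5.34 / Theorem 5.35 for singular
inputs and general channels.

## Tree / Mathlib search (2026-08-31)

REUSED, not restated: `quantumRelEntropy_unitary_conj`, `quantumRelEntropy_smul_smul`, `ker_le_of_posDef`,
`quantumRelEntropy_diagonal_ofReal`, `quantumRelEntropy_uniform` (`KleinInequality`),
`re_trace_traceRight_mul_log_sub_log_le`, `tendsto_cfc_of_density`, `mul_cfc_log_eq_cfc_mul_log`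
(`RelativeEntropyMonotonicity(Density)`), `posSemidef_blockDiagonal` (`ConditionalEntropyConcavity`),
`trNorm`, `trNorm_of_isHermitian`, `trNorm_smul_le` (`QuantumLeftoverHash*`), `two_mul_tvDist_sq_le_kl`
(`Probability/Entropy/PinskerInequality`). The block-diagonal plumbing (`cfc_blockDiagonal`, …) and the
path lemmas are private copies of the private helpers of `QuantumLattice/LiebConcavity` and
`RelativeEntropyMonotonicityDensity`. `rg -il "pinsker"` over `Literature/{InformationTheory,LinearAlgebra,
MathematicalPhysics/QuantumLattice}` → nothing quantum (the classical forms live in `Probability/Entropy`,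
`Analysis/FunctionSpaces/CsiszarKullbackPinsker`, `Computability/QuantumComplexity/EntropyCeiling`);
`rg "mixed.unitary|dephas|pinch"` over the Entropy files → only the one-wire Pauli pinching of
`Computability/QuantumComplexity/EntropyUncertaintyCeiling` (`quantumRelEntropy_pauliPinch_le`, two-point).
Mathlib: `Matrix.IsUnit.posDef_star_left/right_conjugate_iff`, `Matrix.det_blockDiagonal`,
`Fintype.sum_equiv`, `le_of_tendsto_of_tendsto`.

## References

* J. Watrous, *The Theory of Quantum Information* (CUP 2018), §5.2.3: Theorem 5.32, Corollary 5.33,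
  Proposition 5.34, Theorem 5.38 (eqs. (5.167)–(5.173), (5.190)–(5.194)); §5.1.2 Theorem 5.15. [Watrous2018]
* M. A. Nielsen, I. L. Chuang, *Quantum Computation and Quantum Information* (CUP 2010), Theorem 11.7
  (Klein's inequality, equality case), Theorem 11.8 (2). [NielsenChuang2010]
* G. Lindblad, Commun. Math. Phys. 40 (1975) 147–151, Lemma 2. [Lindblad1975]
-/

noncomputable section

open Matrix Filter Topology
open scoped BigOperators ComplexOrder

namespace Literature.InformationTheory.Entropy

open Literature.Computability.QuantumComplexity (traceRight IsDensity traceRight_apply trace_traceRight)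
open Literature.LinearAlgebra.Matrix (cfc_eq_conj_diagonal trace_unitary_conj isHermitian_cfc)
open QuantumLeftoverHash (trNorm trNorm_of_isHermitian trNorm_nonneg trNorm_smul_le trNorm_zero)

variable {d : Type*} [Fintype d] [DecidableEq d]

/-! ### §1 Joint convexity of the relative entropy over finite positive definite families -/

section JointConvexity

variable {ι : Type*} [Fintype ι] [DecidableEq ι]

omit [Fintype d] [DecidableEq d] in
/-- `Tr_ι (⊕ₖ Mₖ) = Σₖ Mₖ` (plumbing; as in `QuantumLattice/LiebConcavity`). [folklore] -/
private theorem traceRight_blockDiagonal (M : ι → Matrix d d ℂ) :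
    traceRight (blockDiagonal M) = ∑ k, M k := by
  ext i j
  simp only [traceRight_apply, blockDiagonal_apply_eq, Matrix.sum_apply]

/-- A block-diagonal matrix with positive definite blocks is positive definite (plumbing). [folklore] -/
private theorem posDef_blockDiagonal {M : ι → Matrix d d ℂ} (hM : ∀ k, (M k).PosDef) :
    (blockDiagonal M).PosDef := by
  refine (posSemidef_blockDiagonal fun k => (hM k).posSemidef).posDef_iff_isUnit.mpr ?_
  rw [Matrix.isUnit_iff_isUnit_det, det_blockDiagonal]
  exact IsUnit.mk0 _ (Finset.prod_ne_zero_iff.mpr fun k _ =>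
    (Matrix.isUnit_iff_isUnit_det _ |>.mp (hM k).isUnit).ne_zero)

/-- `f(⊕ₖ Mₖ) = ⊕ₖ f(Mₖ)` for Hermitian blocks (plumbing; as in `QuantumLattice/LiebConcavity`). [folklore] -/
private theorem cfc_blockDiagonal {M : ι → Matrix d d ℂ} (hM : ∀ k, (M k).IsHermitian) (f : ℝ → ℝ) :
    cfc f (blockDiagonal M) = blockDiagonal fun k => cfc f (M k) := by
  set W : ι → Matrix d d ℂ := fun k => ((hM k).eigenvectorUnitary : Matrix d d ℂ) with hW
  have hWu : ∀ k, W k ∈ Matrix.unitaryGroup d ℂ := fun k => (hM k).eigenvectorUnitary.2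
  have hMW : ∀ k, M k = W k * diagonal (fun j => (((hM k).eigenvalues j : ℝ) : ℂ)) * star (W k) :=
    fun k => (hM k).spectral_theorem
  have hs : star (blockDiagonal W) = blockDiagonal fun k => star (W k) := by
    rw [Matrix.star_eq_conjTranspose, blockDiagonal_conjTranspose]; rfl
  have hBu : blockDiagonal W ∈ Matrix.unitaryGroup (d × ι) ℂ := by
    rw [Matrix.mem_unitaryGroup_iff, hs, ← blockDiagonal_mul, ← blockDiagonal_one]
    congr 1
    funext k
    exact Matrix.mem_unitaryGroup_iff.mp (hWu k)
  have hBD : blockDiagonal M = blockDiagonal W *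
      diagonal (fun jk : d × ι => (((hM jk.2).eigenvalues jk.1 : ℝ) : ℂ)) * star (blockDiagonal W) := by
    rw [hs, ← blockDiagonal_diagonal (fun k j => (((hM k).eigenvalues j : ℝ) : ℂ)), ← blockDiagonal_mul,
      ← blockDiagonal_mul]
    congr 1
    funext k
    exact hMW k
  have h1 : cfc f (blockDiagonal M) = blockDiagonal W *
      diagonal (fun jk : d × ι => ((f ((hM jk.2).eigenvalues jk.1) : ℝ) : ℂ)) * star (blockDiagonal W) :=
    cfc_eq_conj_diagonal hBu hBD f
  have h2 : ∀ k, cfc f (M k) = W k * diagonal (fun j => ((f ((hM k).eigenvalues j) : ℝ) : ℂ)) * star (W k) :=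
    fun k => cfc_eq_conj_diagonal (hWu k) (hMW k) f
  rw [h1, hs, ← blockDiagonal_diagonal (fun k j => ((f ((hM k).eigenvalues j) : ℝ) : ℂ)), ← blockDiagonal_mul,
    ← blockDiagonal_mul]
  congr 1
  funext k
  exact (h2 k).symm

/-- `D(⊕ₖ ρₖ ‖ ⊕ₖ σₖ) = Σₖ D(ρₖ‖σₖ)` (plumbing). [folklore] -/
private theorem quantumRelEntropy_blockDiagonal {ρ σ : ι → Matrix d d ℂ} (hρ : ∀ k, (ρ k).IsHermitian)
    (hσ : ∀ k, (σ k).IsHermitian) :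
    quantumRelEntropy (blockDiagonal ρ) (blockDiagonal σ) = ∑ k, quantumRelEntropy (ρ k) (σ k) := by
  unfold quantumRelEntropy
  rw [cfc_blockDiagonal hρ, cfc_blockDiagonal hσ, ← blockDiagonal_sub, ← blockDiagonal_mul,
    trace_blockDiagonal, Complex.re_sum]
  rfl

/-- **Joint convexity of the quantum relative entropy, finite positive definite families**
(Watrous Theorem 5.32 / Corollary 5.33 iterated; here, as in the tree's two-point
`QuantumLattice.quantumRelEntropy_convex_combination_le`, from Lindblad's monotonicity under the partial
trace applied to the block-diagonal pair `(⊕ₓ ρₓ, ⊕ₓ σₓ)`, whose partial trace over the block label is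
`(Σₓ ρₓ, Σₓ σₓ)`): `D(Σₓ ρₓ ‖ Σₓ σₓ) ≤ Σₓ D(ρₓ‖σₓ)` for positive definite `ρₓ, σₓ`.
[cite: Watrous2018, Theorem 5.32 and Corollary 5.33] [cite: Lindblad1975, Lemma 2 p.149] -/
theorem quantumRelEntropy_sum_le {ρ σ : ι → Matrix d d ℂ} (hρ : ∀ x, (ρ x).PosDef)
    (hσ : ∀ x, (σ x).PosDef) :
    quantumRelEntropy (∑ x, ρ x) (∑ x, σ x) ≤ ∑ x, quantumRelEntropy (ρ x) (σ x) := by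
  have h := re_trace_traceRight_mul_log_sub_log_le (posDef_blockDiagonal hρ) (posDef_blockDiagonal hσ)
  rw [traceRight_blockDiagonal, traceRight_blockDiagonal] at h
  have hsplit := quantumRelEntropy_blockDiagonal (fun x => (hρ x).1) (fun x => (hσ x).1)
  unfold quantumRelEntropy at hsplit ⊢
  rw [hsplit] at h
  exact h

/-- **Joint convexity, weighted form** (Watrous Corollary 5.33 iterated): for weights `pₓ ≥ 0` and
positive definite `ρₓ, σₓ`, `D(Σₓ pₓρₓ ‖ Σₓ pₓσₓ) ≤ Σₓ pₓ D(ρₓ‖σₓ)` (zero weights dropped, the positive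
ones absorbed by (5.99)). [cite: Watrous2018, Corollary 5.33 eq. (5.169)] -/
theorem quantumRelEntropy_convexComb_le {ρ σ : ι → Matrix d d ℂ} (hρ : ∀ x, (ρ x).PosDef)
    (hσ : ∀ x, (σ x).PosDef) {p : ι → ℝ} (hp : ∀ x, 0 ≤ p x) :
    quantumRelEntropy (∑ x, ((p x : ℝ) : ℂ) • ρ x) (∑ x, ((p x : ℝ) : ℂ) • σ x) ≤
      ∑ x, p x * quantumRelEntropy (ρ x) (σ x) := by
  -- restrict to the support of `p`
  set s : Finset ι := Finset.univ.filter (fun x => 0 < p x) with hs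
  have hvan : ∀ (M : ι → Matrix d d ℂ), ∑ x, ((p x : ℝ) : ℂ) • M x = ∑ x ∈ s, ((p x : ℝ) : ℂ) • M x := by
    intro M
    rw [hs, Finset.sum_filter_of_ne]
    intro x _ hne
    by_contra hnot
    have : p x = 0 := le_antisymm (not_lt.1 hnot) (hp x)
    exact hne (by rw [this, Complex.ofReal_zero, zero_smul])
  have hvan' : ∑ x, p x * quantumRelEntropy (ρ x) (σ x) =
      ∑ x ∈ s, p x * quantumRelEntropy (ρ x) (σ x) := by
    rw [hs, Finset.sum_filter_of_ne]
    intro x _ hne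
    by_contra hnot
    have : p x = 0 := le_antisymm (not_lt.1 hnot) (hp x)
    exact hne (by rw [this, zero_mul])
  rw [hvan ρ, hvan σ, hvan', ← Finset.sum_coe_sort s, ← Finset.sum_coe_sort s, ← Finset.sum_coe_sort s]
  have hpos : ∀ x : s, 0 < p x := fun x => (Finset.mem_filter.1 x.2).2
  have hρ' : ∀ x : s, (((p x : ℝ) : ℂ) • ρ x).PosDef := fun x =>
    (hρ x).smul (Complex.zero_lt_real.mpr (hpos x))
  have hσ' : ∀ x : s, (((p x : ℝ) : ℂ) • σ x).PosDef := fun x =>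
    (hσ x).smul (Complex.zero_lt_real.mpr (hpos x))
  refine (quantumRelEntropy_sum_le hρ' hσ').trans (le_of_eq (Finset.sum_congr rfl fun x _ => ?_))
  rw [quantumRelEntropy_smul_smul (hρ x).posSemidef (hσ x).posSemidef (ker_le_of_posDef (hσ x))
    (hpos x) (hpos x), div_self (ne_of_gt (hpos x)), Real.log_one, mul_zero, zero_mul, add_zero]

end JointConvexity

/-! ### §2 Monotonicity under mixed-unitary channels (Watrous Proposition 5.34) -/

section MixedUnitary

/-- A unitary matrix is a unit. [folklore] -/
private theorem isUnit_of_mem_unitaryGroup {U : Matrix d d ℂ} (hU : U ∈ Matrix.unitaryGroup d ℂ) :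
    IsUnit U :=
  ⟨⟨U, star U, Unitary.mul_star_self_of_mem hU, Unitary.star_mul_self_of_mem hU⟩, rfl⟩

/-- **Watrous Proposition 5.34** (positive definite inputs): for a mixed-unitary channel
`Φ(X) = Σₐ p(a) Uₐ X Uₐ⋆` (`Uₐ` unitary, `p` a probability vector),
`D(Φ(ρ)‖Φ(σ)) ≤ D(ρ‖σ)` — joint convexity plus unitary invariance (Proposition 5.19), as printed.
[cite: Watrous2018, Proposition 5.34 eqs. (5.171)–(5.173)] -/
theorem quantumRelEntropy_mixedUnitary_le {ι : Type*} [Fintype ι] [DecidableEq ι]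
    {U : ι → Matrix d d ℂ} (hU : ∀ a, U a ∈ Matrix.unitaryGroup d ℂ) {p : ι → ℝ}
    (hp : ∀ a, 0 ≤ p a) (hp1 : ∑ a, p a = 1) {ρ σ : Matrix d d ℂ} (hρ : ρ.PosDef) (hσ : σ.PosDef) :
    quantumRelEntropy (∑ a, ((p a : ℝ) : ℂ) • (U a * ρ * star (U a)))
        (∑ a, ((p a : ℝ) : ℂ) • (U a * σ * star (U a))) ≤ quantumRelEntropy ρ σ := by
  have hρa : ∀ a, (U a * ρ * star (U a)).PosDef := fun a =>
    (Matrix.IsUnit.posDef_star_right_conjugate_iff (isUnit_of_mem_unitaryGroup (hU a))).2 hρ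
  have hσa : ∀ a, (U a * σ * star (U a)).PosDef := fun a =>
    (Matrix.IsUnit.posDef_star_right_conjugate_iff (isUnit_of_mem_unitaryGroup (hU a))).2 hσ
  refine (quantumRelEntropy_convexComb_le hρa hσa hp).trans (le_of_eq ?_)
  simp_rw [quantumRelEntropy_unitary_conj (hU _) hρ.1 hσ.1, ← Finset.sum_mul, hp1, one_mul]

end MixedUnitary

/-! ### §3 The pinching to the diagonal (complete dephasing) does not increase `D` -/

section Pinching

/-- The sign unitaries `S_s = diag((−1)^{s_i})`, `s : d → Bool`. [folklore] -/
private theorem signDiag_mem_unitaryGroup (s : d → Bool) :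
    diagonal (fun i => if s i then (1 : ℂ) else -1) ∈ Matrix.unitaryGroup d ℂ := by
  rw [Matrix.mem_unitaryGroup_iff, Matrix.star_eq_conjTranspose, diagonal_conjTranspose,
    diagonal_mul_diagonal, ← diagonal_one]
  congr 1
  funext i
  by_cases h : s i <;> simp [h]

omit [Fintype d] in
/-- The sign matrices are self-adjoint (plumbing). [folklore] -/
private theorem star_signDiag (s : d → Bool) :
    star (diagonal (fun i => if s i then (1 : ℂ) else -1)) = diagonal (fun i => if s i then (1 : ℂ) else -1) := by
  rw [Matrix.star_eq_conjTranspose, diagonal_conjTranspose]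
  congr 1
  funext i
  by_cases h : s i <;> simp [h]

/-- Entries of a sign conjugation: `(S_s X S_s)_{ij} = ε_i ε_j X_{ij}`. [folklore] -/
private theorem signDiag_conj_apply (s : d → Bool) (X : Matrix d d ℂ) (i j : d) :
    (diagonal (fun i => if s i then (1 : ℂ) else -1) * X *
        star (diagonal (fun i => if s i then (1 : ℂ) else -1))) i j =
      (if s i then (1 : ℂ) else -1) * (if s j then (1 : ℂ) else -1) * X i j := by
  rw [star_signDiag, Matrix.mul_diagonal, Matrix.diagonal_mul]
  ring

omit [Fintype d] in
/-- Off the diagonal the signs average out: `Σ_s ε_i(s) ε_j(s) = 0` for `i ≠ j` (flip `s_i`). [folklore] -/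
private theorem sum_sign_mul_sign_eq_zero [Fintype d] {i j : d} (hij : i ≠ j) :
    ∑ s : d → Bool, (if s i then (1 : ℂ) else -1) * (if s j then (1 : ℂ) else -1) = 0 := by
  -- the involution flipping the `i`-th sign
  set e : (d → Bool) ≃ (d → Bool) :=
    { toFun := fun s => Function.update s i (!s i)
      invFun := fun s => Function.update s i (!s i)
      left_inv := fun s => by
        funext k
        by_cases hk : k = i
        · subst hk; simp
        · simp [Function.update_of_ne hk]
      right_inv := fun s => by
        funext k
        by_cases hk : k = i
        · subst hk; simp
        · simp [Function.update_of_ne hk] } with he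
  have hflip : ∀ s : d → Bool,
      (if (e s) i then (1 : ℂ) else -1) * (if (e s) j then (1 : ℂ) else -1) =
        -((if s i then (1 : ℂ) else -1) * (if s j then (1 : ℂ) else -1)) := by
    intro s
    have h1 : (e s) i = !s i := by simp [he]
    have h2 : (e s) j = s j := by simp [he, Function.update_of_ne hij.symm]
    rw [h1, h2]
    rcases Bool.eq_false_or_eq_true (s i) with hi | hi <;>
      rcases Bool.eq_false_or_eq_true (s j) with hj | hj <;> simp [hi, hj]
  have hsum := Fintype.sum_equiv e
    (fun s => (if (e s) i then (1 : ℂ) else -1) * (if (e s) j then (1 : ℂ) else -1))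
    (fun s => (if s i then (1 : ℂ) else -1) * (if s j then (1 : ℂ) else -1)) (fun _ => rfl)
  simp_rw [hflip, Finset.sum_neg_distrib] at hsum
  -- `-S = S` forces `S = 0`
  have : (2 : ℂ) * ∑ s : d → Bool, (if s i then (1 : ℂ) else -1) * (if s j then (1 : ℂ) else -1) = 0 := by
    linear_combination -hsum
  simpa using this

/-- **The complete dephasing as a mixed-unitary channel**: averaging the sign conjugations over
all `s : d → Bool` pinches a matrix to its diagonal,
`2^{-|d|} Σ_s S_s X S_s = diag(X_{11}, …, X_{dd})`. [cite: Watrous2018, §4.1.2 (completely dephasing channel is mixed-unitary; cf. proof of Theorem 5.35)] -/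
theorem sum_signDiag_conj_eq_diagonal (X : Matrix d d ℂ) :
    ∑ s : d → Bool, (((Fintype.card (d → Bool) : ℝ)⁻¹ : ℝ) : ℂ) •
        (diagonal (fun i => if s i then (1 : ℂ) else -1) * X *
          star (diagonal (fun i => if s i then (1 : ℂ) else -1))) = diagonal X.diag := by
  ext i j
  simp only [Matrix.sum_apply, Matrix.smul_apply, signDiag_conj_apply, smul_eq_mul, ← Finset.mul_sum]
  by_cases hij : i = j
  · subst hij
    have hsq : ∀ s : d → Bool, (if s i then (1 : ℂ) else -1) * (if s i then (1 : ℂ) else -1) * X i i = X i i := by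
      intro s; split_ifs <;> ring
    simp_rw [hsq, Finset.sum_const, Finset.card_univ, nsmul_eq_mul, diagonal_apply_eq, Matrix.diag_apply]
    rw [← mul_assoc]
    have hc : (Fintype.card (d → Bool) : ℂ) ≠ 0 := Nat.cast_ne_zero.2 Fintype.card_ne_zero
    push_cast
    rw [inv_mul_cancel₀ hc, one_mul]
  · rw [diagonal_apply_ne _ hij]
    have : ∑ s : d → Bool, (if s i then (1 : ℂ) else -1) * (if s j then (1 : ℂ) else -1) * X i j = 0 := by
      rw [← Finset.sum_mul, sum_sign_mul_sign_eq_zero hij, zero_mul]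
    rw [this, mul_zero]

/-- **The pinching to the diagonal does not increase the relative entropy** (positive definite
pair): `D(diag ρ ‖ diag σ) ≤ D(ρ‖σ)` — Proposition 5.34 for the completely dephasing channel,
the measurement step (5.193) of the quantum Pinsker inequality. [cite: Watrous2018, Proposition 5.34 and Theorem 5.38 (proof, eq. (5.193))] -/
theorem quantumRelEntropy_diagonal_diag_le {ρ σ : Matrix d d ℂ} (hρ : ρ.PosDef) (hσ : σ.PosDef) :
    quantumRelEntropy (diagonal ρ.diag) (diagonal σ.diag) ≤ quantumRelEntropy ρ σ := by
  have hcard : (0 : ℝ) < Fintype.card (d → Bool) := Nat.cast_pos.2 Fintype.card_pos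
  have h := quantumRelEntropy_mixedUnitary_le (ι := d → Bool) signDiag_mem_unitaryGroup
    (p := fun _ => (Fintype.card (d → Bool) : ℝ)⁻¹) (fun _ => (inv_pos.2 hcard).le)
    (by rw [Finset.sum_const, Finset.card_univ, nsmul_eq_mul, mul_inv_cancel₀ hcard.ne']) hρ hσ
  rwa [sum_signDiag_conj_eq_diagonal, sum_signDiag_conj_eq_diagonal] at h

end Pinching

/-! ### §4 The quantum Pinsker inequality (Watrous Theorem 5.38) -/

section Pinsker

open Literature.Probability.MarkovChains (tvDist)

/-- A Hermitian matrix with vanishing trace norm is zero. [cite: Watrous2018, §1.1.3 (the trace norm is a norm)] -/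
theorem eq_zero_of_trNorm_eq_zero {S : Matrix d d ℂ} (hS : S.IsHermitian) (h : trNorm S = 0) : S = 0 := by
  rw [trNorm_of_isHermitian hS] at h
  have hall : ∀ i, hS.eigenvalues i = 0 := fun i =>
    abs_eq_zero.mp ((Finset.sum_eq_zero_iff_of_nonneg fun j _ => abs_nonneg _).mp h i (Finset.mem_univ i))
  exact hS.eigenvalues_eq_zero_iff.mp (funext hall)

/-- Unrotating a unitary conjugation: `U (U⋆ X U) U⋆ = X`. [folklore] -/
private theorem unitary_conj_conj {U : Matrix d d ℂ} (hU : U ∈ Matrix.unitaryGroup d ℂ) (X : Matrix d d ℂ) :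
    U * (star U * X * U) * star U = X := by
  have h1 : U * star U = 1 := Unitary.mul_star_self_of_mem hU
  simp only [Matrix.mul_assoc]
  rw [← Matrix.mul_assoc U (star U), h1, Matrix.one_mul, Matrix.mul_one]

/-- **Quantum Pinsker inequality, positive definite case**: for positive definite density operators
`ρ, σ`, `D(ρ‖σ) ≥ ½ ‖ρ − σ‖₁²` (natural logarithm; Watrous' `1/(2 ln 2)` is the base-2 form).
Proof as printed, with the measurement realised as the complete dephasing in the eigenbasis of
`ρ − σ` (where `ρ − σ` is diagonal, so the diagonals `p, q` have `‖p − q‖₁ = ‖ρ − σ‖₁`, (5.191)):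
`D(ρ‖σ) ≥ D(diag p‖diag q) = D(p‖q)` ((5.193), `quantumRelEntropy_diagonal_diag_le`) and the
classical Pinsker inequality `D(p‖q) ≥ 2 TV(p,q)²` (Theorem 5.15, the tree's
`Literature.Probability.Entropy.two_mul_tvDist_sq_le_kl`). [cite: Watrous2018, Theorem 5.38 eqs. (5.190)–(5.194)] -/
theorem half_trNorm_sq_le_quantumRelEntropy_of_posDef {ρ σ : Matrix d d ℂ} (hρ : ρ.PosDef)
    (hσ : σ.PosDef) (hρtr : ρ.trace = 1) (hσtr : σ.trace = 1) :
    (1 / 2) * trNorm (ρ - σ) ^ 2 ≤ quantumRelEntropy ρ σ := by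
  have hH : (ρ - σ).IsHermitian := hρ.1.sub hσ.1
  obtain ⟨U, hUdef⟩ : ∃ U : Matrix d d ℂ, U = (hH.eigenvectorUnitary : Matrix d d ℂ) := ⟨_, rfl⟩
  have hU : U ∈ Matrix.unitaryGroup d ℂ := hUdef ▸ hH.eigenvectorUnitary.2
  have hHU : ρ - σ = U * diagonal (fun i => ((hH.eigenvalues i : ℝ) : ℂ)) * star U := by
    rw [hUdef]; exact hH.spectral_theorem
  have hUs : star U * U = 1 := Unitary.star_mul_self_of_mem hU
  -- rotate to the eigenbasis of `ρ - σ`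
  set ρ' : Matrix d d ℂ := star U * ρ * U with hρ'def
  set σ' : Matrix d d ℂ := star U * σ * U with hσ'def
  have hρ' : ρ'.PosDef :=
    (Matrix.IsUnit.posDef_star_left_conjugate_iff (isUnit_of_mem_unitaryGroup hU)).2 hρ
  have hσ' : σ'.PosDef :=
    (Matrix.IsUnit.posDef_star_left_conjugate_iff (isUnit_of_mem_unitaryGroup hU)).2 hσ
  have hD : quantumRelEntropy ρ σ = quantumRelEntropy ρ' σ' := by
    conv_lhs => rw [← unitary_conj_conj hU ρ, ← unitary_conj_conj hU σ]
    exact quantumRelEntropy_unitary_conj hU hρ'.1 hσ'.1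
  have hdiff : ρ' - σ' = diagonal (fun i => ((hH.eigenvalues i : ℝ) : ℂ)) := by
    rw [hρ'def, hσ'def, ← Matrix.sub_mul, ← Matrix.mul_sub]
    conv_lhs => rw [hHU]
    simp only [Matrix.mul_assoc]
    rw [hUs, Matrix.mul_one, ← Matrix.mul_assoc, hUs, Matrix.one_mul]
  have htrρ' : ρ'.trace = 1 := by
    have := trace_unitary_conj (Unitary.star_mem hU) ρ
    rw [star_star] at this
    rw [hρ'def, this, hρtr]
  have htrσ' : σ'.trace = 1 := by
    have := trace_unitary_conj (Unitary.star_mem hU) σ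
    rw [star_star] at this
    rw [hσ'def, this, hσtr]
  -- the diagonals `p, q`
  set p : d → ℝ := fun i => (ρ' i i).re with hpdef
  set q : d → ℝ := fun i => (σ' i i).re with hqdef
  have hp : ∀ i, 0 < p i := fun i => (Complex.lt_def.1 (hρ'.diag_pos (i := i))).1
  have hq : ∀ i, 0 < q i := fun i => (Complex.lt_def.1 (hσ'.diag_pos (i := i))).1
  have hpi : ∀ i, ((p i : ℝ) : ℂ) = ρ' i i := fun i =>
    Complex.ext (by simp [hpdef]) (by simpa [hpdef] using (Complex.lt_def.1 (hρ'.diag_pos (i := i))).2)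
  have hqi : ∀ i, ((q i : ℝ) : ℂ) = σ' i i := fun i =>
    Complex.ext (by simp [hqdef]) (by simpa [hqdef] using (Complex.lt_def.1 (hσ'.diag_pos (i := i))).2)
  have hp1 : ∑ i, p i = 1 := by
    have h := congrArg Complex.re htrρ'
    simpa [Matrix.trace, hpdef] using h
  have hq1 : ∑ i, q i = 1 := by
    have h := congrArg Complex.re htrσ'
    simpa [Matrix.trace, hqdef] using h
  have hpq : ∀ i, p i - q i = hH.eigenvalues i := by
    intro i
    have h := congrFun (congrFun hdiff i) i
    rw [Matrix.sub_apply, diagonal_apply_eq] at h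
    have h' := congrArg Complex.re h
    simpa [hpdef, hqdef] using h'
  have hdiagρ : diagonal ρ'.diag = diagonal (fun i => ((p i : ℝ) : ℂ)) := by
    congr 1; funext i; rw [Matrix.diag_apply, hpi]
  have hdiagσ : diagonal σ'.diag = diagonal (fun i => ((q i : ℝ) : ℂ)) := by
    congr 1; funext i; rw [Matrix.diag_apply, hqi]
  -- the chain (5.191)–(5.194)
  calc (1 / 2) * trNorm (ρ - σ) ^ 2 = 2 * tvDist p q ^ 2 := by
        rw [trNorm_of_isHermitian hH, tvDist]
        simp_rw [hpq]
        ring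
    _ ≤ ∑ i, p i * Real.log (p i / q i) :=
        Literature.Probability.Entropy.two_mul_tvDist_sq_le_kl hp hq hp1 hq1
    _ = quantumRelEntropy (diagonal fun i => ((p i : ℝ) : ℂ)) (diagonal fun i => ((q i : ℝ) : ℂ)) := by
        rw [quantumRelEntropy_diagonal_ofReal]
        exact Finset.sum_congr rfl fun i _ => by rw [Real.log_div (hp i).ne' (hq i).ne']
    _ = quantumRelEntropy (diagonal ρ'.diag) (diagonal σ'.diag) := by rw [hdiagρ, hdiagσ]
    _ ≤ quantumRelEntropy ρ' σ' := quantumRelEntropy_diagonal_diag_le hρ' hσ'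
    _ = quantumRelEntropy ρ σ := hD.symm

/-! #### The approximation `ρ_ε = (1 − ε)ρ + εσ` (Petz) for a singular first argument -/

omit [DecidableEq d] in
/-- `x ↦ Re Tr (A x)` inherits limits from `A`. [folklore] -/
private theorem tendsto_re_trace' {X : Type*} {l : Filter X} {A : X → Matrix d d ℂ} {A₀ : Matrix d d ℂ}
    (h : Tendsto A l (𝓝 A₀)) : Tendsto (fun x => ((A x).trace).re) l (𝓝 (A₀.trace).re) :=
  ((Complex.continuous_re.comp (continuous_id.matrix_trace)).tendsto A₀).comp h

omit [Fintype d] [DecidableEq d] in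
/-- Along `ε → 0⁺`, `(1 − ε) ρ + ε σ → ρ`. [folklore] -/
private theorem tendsto_path' (ρ σ : Matrix d d ℂ) :
    Tendsto (fun ε : ℝ => (((1 - ε : ℝ) : ℂ)) • ρ + ((ε : ℝ) : ℂ) • σ) (𝓝[>] 0) (𝓝 ρ) := by
  have hc : Continuous fun ε : ℝ => (((1 - ε : ℝ) : ℂ)) • ρ + ((ε : ℝ) : ℂ) • σ :=
    ((Complex.continuous_ofReal.comp (continuous_const.sub continuous_id)).smul continuous_const).add
      ((Complex.continuous_ofReal.comp continuous_id).smul continuous_const)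
  have h := (hc.tendsto 0).mono_left (nhdsWithin_le_nhds (s := Set.Ioi (0:ℝ)))
  simpa using h

omit [Fintype d] [DecidableEq d] in
/-- For `ε ∈ (0, 1]` the path is positive definite. [cite: Petz2008, proof of Theorem 3.10] -/
private theorem posDef_path' {ρ σ : Matrix d d ℂ} (hρ : ρ.PosSemidef) (hσ : σ.PosDef) {ε : ℝ}
    (h0 : 0 < ε) (h1 : ε ≤ 1) : ((((1 - ε : ℝ) : ℂ)) • ρ + ((ε : ℝ) : ℂ) • σ).PosDef :=
  Matrix.PosDef.posSemidef_add (hρ.smul (Complex.zero_le_real.mpr (by linarith)))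
    (hσ.smul (Complex.zero_lt_real.mpr h0))

omit [DecidableEq d] in
/-- The path stays of trace one. [folklore] -/
private theorem trace_path' {ρ σ : Matrix d d ℂ} (hρ : ρ.trace = 1) (hσ : σ.trace = 1) (ε : ℝ) :
    ((((1 - ε : ℝ) : ℂ)) • ρ + ((ε : ℝ) : ℂ) • σ).trace = 1 := by
  rw [Matrix.trace_add, Matrix.trace_smul, Matrix.trace_smul, hρ, hσ, smul_eq_mul, smul_eq_mul,
    mul_one, mul_one, ← Complex.ofReal_add, sub_add_cancel, Complex.ofReal_one]

/-- `D(ρ_ε ‖ σ) → D(ρ ‖ σ)` as `ε → 0⁺` (the "approximation argument"; same proof as the tree's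
`RelativeEntropyMonotonicityDensity`). [cite: Petz2008, proof of Theorem 3.10] -/
private theorem tendsto_quantumRelEntropy_path {ρ σ : Matrix d d ℂ} (hρ : ρ.PosSemidef)
    (hρtr : ρ.trace = 1) (hσ : σ.PosDef) (hσtr : σ.trace = 1) :
    Tendsto (fun ε : ℝ => quantumRelEntropy ((((1 - ε : ℝ) : ℂ)) • ρ + ((ε : ℝ) : ℂ) • σ) σ)
      (𝓝[>] 0) (𝓝 (quantumRelEntropy ρ σ)) := by
  have hdens : ∀ᶠ ε in 𝓝[>] (0 : ℝ),
      ((((1 - ε : ℝ) : ℂ)) • ρ + ((ε : ℝ) : ℂ) • σ).PosSemidef ∧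
        ((((1 - ε : ℝ) : ℂ)) • ρ + ((ε : ℝ) : ℂ) • σ).trace = 1 := by
    filter_upwards [Ioo_mem_nhdsGT (zero_lt_one' ℝ)] with ε hε
    exact ⟨(posDef_path' hρ hσ hε.1 hε.2.le).posSemidef, trace_path' hρtr hσtr ε⟩
  have hcfc := tendsto_cfc_of_density (fun t => t * Real.log t)
    (Real.continuous_mul_log.continuousOn) (tendsto_path' ρ σ) hdens hρ hρtr
  have h1 := tendsto_re_trace' hcfc
  have h2 := tendsto_re_trace' ((tendsto_path' ρ σ).mul (tendsto_const_nhds (x := cfc Real.log σ)))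
  have key : ∀ (A : Matrix d d ℂ), A.IsHermitian → quantumRelEntropy A σ =
      ((cfc (fun t => t * Real.log t) A).trace).re - ((A * cfc Real.log σ).trace).re := by
    intro A hA
    unfold quantumRelEntropy
    rw [Matrix.mul_sub, Matrix.trace_sub, Complex.sub_re, mul_cfc_log_eq_cfc_mul_log hA]
  rw [key ρ hρ.1]
  refine ((h1.sub h2).congr' ?_)
  filter_upwards [hdens] with ε hε
  rw [key _ hε.1.1]

/-- **Quantum Pinsker inequality** (Watrous Theorem 5.38; Hiai–Ohya–Tsukada): for a density operator
`ρ` and a positive definite density operator `σ`, `D(ρ‖σ) ≥ ½ ‖ρ − σ‖₁²` (natural logarithm).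
The singular `ρ` is reached from the positive definite case along `ρ_ε = (1−ε)ρ + εσ`, `ε → 0⁺`
(for singular `σ` with `im ρ ⊄ im σ` the source's `D` is `+∞`; with the tree's finite convention the
inequality then genuinely needs `σ ≻ 0`). [cite: Watrous2018, Theorem 5.38 eq. (5.190)] -/
theorem half_trNorm_sq_le_quantumRelEntropy {ρ σ : Matrix d d ℂ} (hρ : IsDensity ρ) (hσ : σ.PosDef)
    (hσtr : σ.trace = 1) : (1 / 2) * trNorm (ρ - σ) ^ 2 ≤ quantumRelEntropy ρ σ := by
  set T := trNorm (ρ - σ) with hT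
  have hT0 : 0 ≤ T := trNorm_nonneg _
  -- the bound along the path
  have hpath : ∀ ε ∈ Set.Ioo (0 : ℝ) 1, (1 / 2) * ((1 - ε) * T) ^ 2 ≤
      quantumRelEntropy ((((1 - ε : ℝ) : ℂ)) • ρ + ((ε : ℝ) : ℂ) • σ) σ := by
    intro ε hε
    have h1ε : 0 < 1 - ε := by linarith [hε.2]
    have hPD := posDef_path' hρ.1 hσ hε.1 hε.2.le
    have hP := half_trNorm_sq_le_quantumRelEntropy_of_posDef hPD hσ (trace_path' hρ.2 hσtr ε) hσtr
    -- `‖ρ_ε − σ‖₁ ≥ (1 − ε) ‖ρ − σ‖₁`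
    have hM : (((1 - ε : ℝ) : ℂ)) • ρ + ((ε : ℝ) : ℂ) • σ - σ = (((1 - ε : ℝ) : ℂ)) • (ρ - σ) := by
      rw [smul_sub, Complex.ofReal_sub, Complex.ofReal_one, sub_smul, one_smul, sub_smul, one_smul]
      abel
    have hMh : ((((1 - ε : ℝ) : ℂ)) • (ρ - σ)).IsHermitian := by
      change ((((1 - ε : ℝ) : ℂ)) • (ρ - σ))ᴴ = _
      rw [conjTranspose_smul, Complex.star_def, Complex.conj_ofReal, (hρ.1.1.sub hσ.1).eq]
    have hscale : (1 - ε) * T ≤ trNorm ((((1 - ε : ℝ) : ℂ)) • (ρ - σ)) := by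
      have h := trNorm_smul_le hMh (inv_pos.2 h1ε).le
      rw [smul_smul, ← Complex.ofReal_mul, inv_mul_cancel₀ h1ε.ne', Complex.ofReal_one, one_smul] at h
      -- `T ≤ (1-ε)⁻¹ ‖M‖₁`
      have := mul_le_mul_of_nonneg_left h h1ε.le
      rwa [← mul_assoc, mul_inv_cancel₀ h1ε.ne', one_mul] at this
    rw [hM] at hP
    calc (1 / 2) * ((1 - ε) * T) ^ 2 ≤ (1 / 2) * trNorm ((((1 - ε : ℝ) : ℂ)) • (ρ - σ)) ^ 2 := by
          gcongr
      _ ≤ _ := hP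
  -- limits
  have hf : Tendsto (fun ε : ℝ => (1 / 2) * ((1 - ε) * T) ^ 2) (𝓝[>] 0) (𝓝 ((1 / 2) * T ^ 2)) := by
    have hc : Continuous fun ε : ℝ => (1 / 2) * ((1 - ε) * T) ^ 2 := by fun_prop
    have h := (hc.tendsto 0).mono_left (nhdsWithin_le_nhds (s := Set.Ioi (0 : ℝ)))
    simpa using h
  have hg := tendsto_quantumRelEntropy_path hρ.1 hρ.2 hσ hσtr
  refine le_of_tendsto_of_tendsto hf hg ?_
  filter_upwards [Ioo_mem_nhdsGT (zero_lt_one' ℝ)] with ε hε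
  exact hpath ε hε

/-- **Equality in Klein's inequality** (Nielsen–Chuang Theorem 11.7: `S(ρ‖σ) ≥ 0` "with equality if
and only if `ρ = σ`"): for a density `ρ` and a positive definite density `σ`, `D(ρ‖σ) ≤ 0 ⟹ ρ = σ`.
[cite: NielsenChuang2010, Theorem 11.7] [cite: Watrous2018, Theorem 5.38] -/
theorem eq_of_quantumRelEntropy_le_zero {ρ σ : Matrix d d ℂ} (hρ : IsDensity ρ) (hσ : σ.PosDef)
    (hσtr : σ.trace = 1) (h : quantumRelEntropy ρ σ ≤ 0) : ρ = σ := by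
  have hP := half_trNorm_sq_le_quantumRelEntropy hρ hσ hσtr
  have hT : trNorm (ρ - σ) = 0 := by
    have h0 : trNorm (ρ - σ) ^ 2 ≤ 0 := by linarith
    exact pow_eq_zero_iff two_ne_zero |>.1 (le_antisymm h0 (sq_nonneg _))
  exact sub_eq_zero.1 (eq_zero_of_trNorm_eq_zero (hρ.1.1.sub hσ.1) hT)

/-- `D(ρ‖σ) = 0 ⟺ ρ = σ` for a density `ρ` and a positive definite density `σ`.
[cite: NielsenChuang2010, Theorem 11.7] -/
theorem quantumRelEntropy_eq_zero_iff {ρ σ : Matrix d d ℂ} (hρ : IsDensity ρ) (hσ : σ.PosDef)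
    (hσtr : σ.trace = 1) : quantumRelEntropy ρ σ = 0 ↔ ρ = σ :=
  ⟨fun h => eq_of_quantumRelEntropy_le_zero hρ hσ hσtr h.le, fun h => by rw [h, quantumRelEntropy_self]⟩

/-- **The completely mixed state is the unique maximiser of the entropy**: `H(ρ) = log d ⟹ ρ = 𝟙/d`
(from `D(ρ ‖ 𝟙/d) = log d − H(ρ)` and the equality case of Klein's inequality).
[cite: NielsenChuang2010, Theorem 11.8 (2)] [cite: Watrous2018, Proposition 5.8 (the analogous Shannon bound, via relative entropy)] -/
theorem eq_uniform_of_vonNeumannEntropy_eq_log_card [Nonempty d] {ρ : Matrix d d ℂ} (hρ : IsDensity ρ)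
    (h : vonNeumannEntropy ρ = Real.log (Fintype.card d)) :
    ρ = ((((Fintype.card d : ℝ)⁻¹ : ℝ) : ℂ)) • (1 : Matrix d d ℂ) := by
  have hc : (0 : ℝ) < (Fintype.card d : ℝ)⁻¹ := inv_pos.2 (Nat.cast_pos.2 Fintype.card_pos)
  have hσ : (((((Fintype.card d : ℝ)⁻¹ : ℝ) : ℂ)) • (1 : Matrix d d ℂ)).PosDef :=
    Matrix.PosDef.one.smul (Complex.zero_lt_real.2 hc)
  have hσtr : (((((Fintype.card d : ℝ)⁻¹ : ℝ) : ℂ)) • (1 : Matrix d d ℂ)).trace = 1 := by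
    rw [Matrix.trace_smul, Matrix.trace_one, smul_eq_mul, ← Complex.ofReal_natCast, ← Complex.ofReal_mul,
      inv_mul_cancel₀ (Nat.cast_ne_zero.2 Fintype.card_ne_zero), Complex.ofReal_one]
  refine eq_of_quantumRelEntropy_le_zero hρ hσ hσtr (le_of_eq ?_)
  rw [quantumRelEntropy_uniform hρ.1.1 hρ.2, h, sub_self]

end Pinsker

end Literature.InformationTheory.Entropy
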